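import Summits.NavierStokesRegularity.NavierStokesRegularity.Theses.SlicedKelvin
import Summits.NavierStokesRegularity.NavierStokesRegularity.Theorems.SlicedKelvinPlanarFluxLiouvilleStubFluxSlicing
import Summits.NavierStokesRegularity.NavierStokesRegularity.Theorems.SlicedKelvinPlanarFluxLiouvilleStubIrrotationalConstant
import HarnessLib.Audit

/-!
# Birth skeleton (BC3) of the crux `SlicedKelvin.PlanarFluxLiouville`

LEAD STATUS (prover-line-stmt-NavierStokesRegularity-15601-0, 2026-08-17, cycle 1): stubs
`stub_fluxSlicing` (p149289) and `stub_irrotationalConstant` (p146534) are LANDED under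
`Theorems/` and imported below (their skeleton declarations are now one-line aliases, no `sorry`);
the skeleton is closed modulo the single load-bearing stub `stub_densityClassIrrotational`
(= the card's (L_G), open problem). Conditional bridge `(L) → PlanarFluxLiouville` landed separately
(`Theorems/SlicedKelvinPlanarFluxLiouvilleOfLiouvilleConjectureNS.lean`, p150006).

(crux item `stmt-NavierStokesRegularity-15601`, rank 3, route `route-NavierStokesRegularity-SlicedKelvin`;
tree path `Cruxes/PlanarFluxLiouville/Lines/birth.lean`; registrar
`planner-skel-stmt-NavierStokesRegularity-15601-0`, 2026-08-17. The route predates the Lean birth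
certificate; this file supplies BC3 retroactively. No `Disproof.lean` exists for this crux yet
(`ledger crux ls`: no workfiles), so there is no `_false_without_` obstruction to honour; the negatives
index (4 entries: FiniteTangentModuli 4055, PerpetualPump 1832, CorrectorSolvable 1429,
BlowupClayNonuniqueness 0154) is untouched — every stub below is SATISFIED by the parasitic drifts
`v(t,x) = b(t)` of the duality-form class (the 4055 witness type): their vorticity vanishes.)

THE CRUX. `PlanarFluxLiouville`: a bounded ancient mild solution `v` of NS (`ν = 1`, KNSS duality-form
class), measurable slices, jointly `C^∞` on `(−∞,0) × ℝ³`, whose vorticity has unsigned flux `≤ M`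
through EVERY plane at every time, is spatially constant on every slice.

THE CUT (the seam the route header itself names: "slicing the Giga–Miyakawa ball density by the three
coordinate foliations gives `sup_{x,r} r⁻¹∫_{B_r}|ω| ≤ 6Φ*`", and "(L_G) (bounded Giga–Miyakawa density,
`G ≤ 6·sup-flux`)" — kinematics in, dynamics, kinematics out):

* `stub_fluxSlicing` [M, kinematic measure theory, provable now]: for ANY field `u : ℝ³ → ℝ³`
  (`curl u` is Borel measurable for every `u`, `measurable_fderiv`, so no regularity hypothesis is
  needed), unsigned flux of `curl u` at most `M` through every plane ⇒ `∫_{B_r(x)} |curl u| ≤ 6 M r` for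
  every ball: `|w| ≤ |w₀|+|w₁|+|w₂|`, the ball lies in each coordinate slab of width `2r`, and the slab
  integral of `|wᵢ|` is `∫ (flux through {yᵢ = c}) dc ≤ 2rM` (Tonelli through the measure-preserving
  `ℝ² × ℝ ≃ ℝ³` composed with the coordinate-permutation isometries `R e₂ = eᵢ`). This is the
  Giga–Miyakawa critical Morrey density `G := sup_{x,r} r⁻¹ ∫_{B_r(x)}|ω| ≤ 6 M`.
* `stub_densityClassIrrotational` [open problem — the load-bearing stub; the card's (L_G) in vorticity
  form, a TRANSFER `C⁺` of the crux]: a bounded ancient mild solution (`ν = 1`), measurable slices,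
  jointly smooth, whose vorticity has bounded critical Morrey density `∫_{B_r(x)}|curl v(t)| ≤ G r`
  (all `t < 0`, `x`, `r > 0`), is IRROTATIONAL: `curl (v t) ≡ 0`. Why the density class is the one to
  attack (not a costume): `G` is invariant under the full similarity group AND localises (balls pass to
  blow-down / tangent-flow limits `x_k, r_k → ∞`, plane integrals do not); `G` is exactly the norm of the
  small-data theory (Giga–Miyakawa 1989: the small-`G` rung of this stub is in print, cf. route support
  `SmallFluxRung`); `G` prices Biot–Savart, `‖v − b‖²_∞ ≤ (2/π)‖ω‖_∞ G` (route support
  `FluxVelocityBound`), and the axisymmetric corner `‖A‖_BMO ≲ G` is Lei–Zhang's theorem. Why it might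
  fail: no Liouville theorem is known in any vorticity-Morrey class without smallness; a bounded ancient
  flow with radially threaded `|y|⁻²` vorticity tails has finite `G`.
* `stub_irrotationalConstant` [M, classical kinematics, provable now from the tree]: a smooth, bounded,
  weakly divergence-free, irrotational field on `ℝ³` is constant — KNSS 2009 Lemma 3.1 ("bounded
  solutions of `curl z = 0`, `div z = 0` are constant by Liouville's theorem"); in tree: star-shaped
  potential `u = ∇θ` (curl-free on `ℝ³`) makes `u` annihilate solenoidal tests, then
  `IsWeaklyDivFree.exists_ae_eq_const_of_norm_le_of_forall_integral_inner_eq_zero`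
  (`Literature/Analysis/FluidPDE/BoundedAnnihilator.lean`) + continuity.

`PlanarFluxLiouville_of_stubs : <sig slicing> → <sig irrotational> → <sig constant> → <crux statement>` is
the REAL composition (closed, axioms `propext`/`Classical.choice`/`Quot.sound`; the stubs enter as
hypotheses) and `PlanarFluxLiouville_of : PlanarFluxLiouville := PlanarFluxLiouville_of_stubs stub_… stub_… stub_…`
is the crux BY NAME (the unique theorem here concluding the crux decl, as the skeleton audit requires): fix `v`, get `M`; slicing applied to each
slice `u := v s` gives the density bound with `G = 6M`; the dynamic stub gives `curl (v s) ≡ 0` for all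
`s < 0`; for the slice `t` extract `ContDiff ℝ ∞ (v t)` from joint smoothness (composition with
`x ↦ (t,x)`), the sup bound from `IsBoundedOn (Iio 0) v` and weak solenoidality from the ancient-solution
structure, and the kinematic stub returns the constant `b`.

BC3 PROBES (folder `bc/probe_*.lean`, `lean check`): for each stub `S`, `S → PlanarFluxLiouville` and
`S → NavierStokesRegularity` by `first | exact? | simpa | aesop` FAIL (results quoted in NOTES.md /
`Lines/birth.md`): no stub is cheaply the crux or the summit.
-/

noncomputable section

open Set MeasureTheory Filter Topology
open Literature.Analysis.FluidPDE

namespace Summit.NavierStokesRegularity.NavierStokesRegularity.Cruxes.PlanarFluxLiouville.Birth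

set_option linter.unusedVariables false
set_option linter.dupNamespace false

/-- **stub 1 — `stub_fluxSlicing` (M, kinematic; provable now).** Unsigned flux of `curl u` at most
`M` through every plane `R {x₂ = c}` ⇒ `∫_{B_r(x)} |curl u| ≤ 6 M r` for every ball (three coordinate
foliations, Tonelli, `‖w‖ ≤ Σ|wᵢ|`). No regularity hypothesis: `curl u` is Borel measurable for every
`u` (`measurable_fderiv`). -/
theorem stub_fluxSlicing :
    ∀ (u : EuclideanSpace ℝ (Fin 3) → EuclideanSpace ℝ (Fin 3)) (M : ℝ),
      (∀ (R : EuclideanSpace ℝ (Fin 3) ≃ₗᵢ[ℝ] EuclideanSpace ℝ (Fin 3)) (c : ℝ),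
          ∫⁻ y : EuclideanSpace ℝ (Fin 2),
              ‖inner ℝ (curl u (R (WithLp.toLp 2 ![y 0, y 1, c]))) (R (EuclideanSpace.single 2 1))‖ₑ
            ≤ ENNReal.ofReal M) →
      ∀ (x : EuclideanSpace ℝ (Fin 3)) (r : ℝ), 0 < r →
        ∫⁻ y in Metric.ball x r, ‖curl u y‖ₑ ≤ ENNReal.ofReal (6 * M * r) :=
  -- LANDED (p149289): `Theorems/SlicedKelvinPlanarFluxLiouvilleStubFluxSlicing.lean`
  Summit.NavierStokesRegularity.NavierStokesRegularity.Theorems.PlanarFluxLiouville.Birth.stub_fluxSlicing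

/-- **stub 2 — `stub_densityClassIrrotational` (open problem; the load-bearing stub = the card's
(L_G) in vorticity form).** A bounded ancient mild solution of NS (`ν = 1`, duality-form class),
measurable slices, jointly smooth on `(−∞,0) × ℝ³`, whose vorticity has bounded critical Morrey
(Giga–Miyakawa) density `∫_{B_r(x)} |curl v(t)| ≤ G r`, is irrotational on every slice. -/
theorem stub_densityClassIrrotational :
    ∀ (v : ℝ → EuclideanSpace ℝ (Fin 3) → EuclideanSpace ℝ (Fin 3)),
      IsBoundedAncientMildSolution 1 v →
      (∀ t < 0, AEStronglyMeasurable (v t) volume) →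
      ContDiffOn ℝ (⊤ : ℕ∞) (Function.uncurry v) (Set.Iio 0 ×ˢ Set.univ) →
      (∃ G : ℝ, ∀ t < 0, ∀ (x : EuclideanSpace ℝ (Fin 3)) (r : ℝ), 0 < r →
          ∫⁻ y in Metric.ball x r, ‖curl (v t) y‖ₑ ≤ ENNReal.ofReal (G * r)) →
      ∀ t < 0, ∀ x : EuclideanSpace ℝ (Fin 3), curl (v t) x = 0 := by
  sorry

/-- **stub 3 — `stub_irrotationalConstant` (M, classical; provable now from the tree).** A smooth,
bounded, weakly divergence-free, irrotational vector field on `ℝ³` is constant (KNSS 2009, Lemma 3.1;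
harmonic Liouville — in tree via the star-shaped potential and
`IsWeaklyDivFree.exists_ae_eq_const_of_norm_le_of_forall_integral_inner_eq_zero`). -/
theorem stub_irrotationalConstant :
    ∀ (u : EuclideanSpace ℝ (Fin 3) → EuclideanSpace ℝ (Fin 3)),
      ContDiff ℝ (⊤ : ℕ∞) u → IsWeaklyDivFree u → (∃ C : ℝ, ∀ x, ‖u x‖ ≤ C) →
      (∀ x, curl u x = 0) → ∃ b : EuclideanSpace ℝ (Fin 3), ∀ x, u x = b :=
  -- LANDED (p146534): `Theorems/SlicedKelvinPlanarFluxLiouvilleStubIrrotationalConstant.lean`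
  Summit.NavierStokesRegularity.NavierStokesRegularity.Theorems.PlanarFluxLiouville.Birth.stub_irrotationalConstant

/-- **Birth composition, hypothesis form (closed).** The three stub STATEMENTS, taken as hypotheses, imply
the crux STATEMENT (spelled out verbatim from `Theses.SlicedKelvin.PlanarFluxLiouville`; the by-name form is
`PlanarFluxLiouville_of` below, which is this theorem applied to the three registered stubs). Axioms:
`propext`, `Classical.choice`, `Quot.sound` only. Slicing is applied slice by slice with `G = 6M`, the
dynamic stub kills the vorticity, and the kinematic stub is fed the slice's smoothness (from joint
smoothness), sup bound (from `IsBoundedOn (Iio 0) v`) and weak solenoidality (from the ancient-solution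
structure). -/
theorem PlanarFluxLiouville_of_stubs :
    (∀ (u : EuclideanSpace ℝ (Fin 3) → EuclideanSpace ℝ (Fin 3)) (M : ℝ),
      (∀ (R : EuclideanSpace ℝ (Fin 3) ≃ₗᵢ[ℝ] EuclideanSpace ℝ (Fin 3)) (c : ℝ),
          ∫⁻ y : EuclideanSpace ℝ (Fin 2),
              ‖inner ℝ (curl u (R (WithLp.toLp 2 ![y 0, y 1, c]))) (R (EuclideanSpace.single 2 1))‖ₑ
            ≤ ENNReal.ofReal M) →
      ∀ (x : EuclideanSpace ℝ (Fin 3)) (r : ℝ), 0 < r →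
        ∫⁻ y in Metric.ball x r, ‖curl u y‖ₑ ≤ ENNReal.ofReal (6 * M * r)) →
    (∀ (v : ℝ → EuclideanSpace ℝ (Fin 3) → EuclideanSpace ℝ (Fin 3)),
      IsBoundedAncientMildSolution 1 v →
      (∀ t < 0, AEStronglyMeasurable (v t) volume) →
      ContDiffOn ℝ (⊤ : ℕ∞) (Function.uncurry v) (Set.Iio 0 ×ˢ Set.univ) →
      (∃ G : ℝ, ∀ t < 0, ∀ (x : EuclideanSpace ℝ (Fin 3)) (r : ℝ), 0 < r →
          ∫⁻ y in Metric.ball x r, ‖curl (v t) y‖ₑ ≤ ENNReal.ofReal (G * r)) →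
      ∀ t < 0, ∀ x : EuclideanSpace ℝ (Fin 3), curl (v t) x = 0) →
    (∀ (u : EuclideanSpace ℝ (Fin 3) → EuclideanSpace ℝ (Fin 3)),
      ContDiff ℝ (⊤ : ℕ∞) u → IsWeaklyDivFree u → (∃ C : ℝ, ∀ x, ‖u x‖ ≤ C) →
      (∀ x, curl u x = 0) → ∃ b : EuclideanSpace ℝ (Fin 3), ∀ x, u x = b) →
    -- the crux statement, verbatim (cf. `Theses.SlicedKelvin.PlanarFluxLiouville`):
    ∀ (v : ℝ → EuclideanSpace ℝ (Fin 3) → EuclideanSpace ℝ (Fin 3)),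
      Literature.Analysis.FluidPDE.IsBoundedAncientMildSolution 1 v →
      (∀ t < 0, MeasureTheory.AEStronglyMeasurable (v t) MeasureTheory.volume) →
      ContDiffOn ℝ (⊤ : ℕ∞) (Function.uncurry v) (Set.Iio 0 ×ˢ Set.univ) →
      (∃ M : ℝ, ∀ t < 0, ∀ (R : EuclideanSpace ℝ (Fin 3) ≃ₗᵢ[ℝ] EuclideanSpace ℝ (Fin 3)) (c : ℝ),
          ∫⁻ y : EuclideanSpace ℝ (Fin 2),
            ‖inner ℝ (Literature.Analysis.FluidPDE.curl (v t) (R (WithLp.toLp 2 ![y 0, y 1, c])))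
              (R (EuclideanSpace.single 2 1))‖ₑ ≤ ENNReal.ofReal M) →
      ∀ t < 0, ∃ b : EuclideanSpace ℝ (Fin 3), ∀ x, v t x = b := by
  intro hslice hirr hconst v hv hmeas hsm hflux t ht
  obtain ⟨M, hM⟩ := hflux
  -- Step 1 (kinematics in): planar flux ≤ M on every plane ⇒ Morrey density with G = 6M, slice by slice.
  have hG : ∃ G : ℝ, ∀ s < 0, ∀ (x : EuclideanSpace ℝ (Fin 3)) (r : ℝ), 0 < r →
      ∫⁻ y in Metric.ball x r, ‖curl (v s) y‖ₑ ≤ ENNReal.ofReal (G * r) :=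
    ⟨6 * M, fun s hs x r hr => hslice (v s) M (hM s hs) x r hr⟩
  -- Step 2 (dynamics): the density-class Liouville stub kills the vorticity on every slice.
  have hω : ∀ s < 0, ∀ x : EuclideanSpace ℝ (Fin 3), curl (v s) x = 0 := hirr v hv hmeas hsm hG
  -- Step 3 (kinematics out): the slice `v t` is smooth, bounded, weakly solenoidal and irrotational.
  have hincl : ∀ x : EuclideanSpace ℝ (Fin 3),
      ((t, x) : ℝ × EuclideanSpace ℝ (Fin 3)) ∈ Set.Iio (0 : ℝ) ×ˢ (Set.univ : Set (EuclideanSpace ℝ (Fin 3))) :=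
    fun x => Set.mk_mem_prod ht (Set.mem_univ x)
  have hvt : ContDiff ℝ (⊤ : ℕ∞) (v t) :=
    hsm.comp_contDiff (contDiff_prodMk_right t) hincl
  have hbdd : ∃ C : ℝ, ∀ x, ‖v t x‖ ≤ C := by
    obtain ⟨C, hC⟩ := hv.2
    exact ⟨C, fun x => hC t ht x⟩
  have hdiv : IsWeaklyDivFree (v t) := hv.1.1 t ht
  exact hconst (v t) hvt hdiv hbdd (hω t ht)

/-- **The skeleton, by name** (A12 convention; the unique theorem of this file concluding the crux decl):
`PlanarFluxLiouville` BY NAME, as the closed composition `PlanarFluxLiouville_of_stubs` applied to exactly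
the three registered stubs (it inherits their placeholders and nothing else; the crux def unfolds to the
composition's conclusion definitionally). -/
theorem PlanarFluxLiouville_of : Theses.SlicedKelvin.PlanarFluxLiouville :=
  PlanarFluxLiouville_of_stubs stub_fluxSlicing stub_densityClassIrrotational stub_irrotationalConstant

end Summit.NavierStokesRegularity.NavierStokesRegularity.Cruxes.PlanarFluxLiouville.Birth
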